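import Literature.NumberTheory.Automorphic.Liu2021.LemD1AsPrintedIndexedNonVacuityAtPlace
import Literature.NumberTheory.GelbartRogawski1991.CMSplittingCharLocalMu
import Literature.NumberTheory.GaloisRepresentations.HeckeCharacterWeakApproximation
import Literature.RepresentationTheory.Liu2021.OscillatorConventions
import Literature.NumberTheory.Automorphic.ConjugateSelfDualCharacters
import Literature.NumberTheory.Automorphic.IdeleClassCharacterHecke
import Literature.NumberTheory.Automorphic.UnitaryInfinityType
import HarnessLib

/-!
# [Liu2021, Def. 4.3 ∕ App. D §D.1 Step 2 ∕ Lemma D.1 (3)] — WEIGHT ONE forces a non-quadratic local component: the rows'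
# own Step-2 slot `localMu L (toHeckeCharacter L ψ) v` has `μ_v(x)² ≠ 1` at infinitely many places

Reproduction ∕ bookkeeping (Literature, THEOREMS ONLY: no definition, no record, no named fact, no `sorry`; nothing is
asserted about Liu's oscillator representations or about the tree's constructed local Weil carriers).

Companion of `LemD1AsPrintedIndexedNonVacuityAtPlace.lean`, whose §7–§8 showed, at EVERY finite place of the place model and
for every Step-2 datum `μ`: `μ(ι_v a)² = 1`, `μ³` is again a Step-2 character, the rows' packaging `LemD1OfPlace.muOf` separates
`μ` from `μ³`, and the two-member trivial-carrier collection `(μ, e, 1), (μ³, e, 1)` passes [Lem. D.1 (1)] and FAILS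
[Lem. D.1 (3)] AS PRINTED (`LemD1_3AsPrintedI`) — all CONDITIONAL on `∃ x, μ(x)² ≠ 1`, which that file discharged only at a split
place and only for a character built for the purpose.  THIS FILE discharges it for the displayed rows' OWN `μ`-slot, from the
displayed rows' OWN binder `hw : HasWeight L ψ 1` ([Liu2021, Def. 4.3] «of weight one»):

* §1 (any number field `K`) **`exists_localComponent_pow_ne_one_of_hasInfinityType`**: a continuous unitary `ψ : C_K → S¹`
  of ∞-type `e` (`IdeleClassGroup.HasInfinityType`) with `e_v ≠ 0` at some COMPLEX place `v` has, outside any finite set `S` of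
  finite places and for every `n ≠ 0`, a finite place `w ∉ S` and `x ∈ K_wˣ` with `ψ_w(x)ⁿ ≠ 1` (`ψ_w` = the local component of
  `toHeckeCharacter ψ`).  Proof: otherwise `(toHeckeCharacter ψ)ⁿ` has trivial local components off `S`, hence is trivial by the
  RIGIDITY of Hecke characters (`K^× 𝕀_K^S` dense in `𝕀_K` — the tree's kernel theorem `HeckeCharacter.eq_one_of_forall_localUnits`,
  [CasselsFrohlichANT1967, Ch. VII §4 Prop. 4.1], from weak approximation); but on the infinite idele concentrated at `v` with
  `ι_v`-value `ζ ∈ S¹` it takes the value `ζ^{n e_v}` (∞-type, tree `infinityTypeChar_singleUnits`), `≠ 1` for a suitable `ζ`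
  (`Complex.exists_norm_eq_one_zpow_ne_one`).  Corollary `exists_localComponent_sq_ne_one_of_hasInfinityType` (`S = ∅`, `n = 2`).
* §2 (the CM rows: `L` CM, `F = L⁺`, `c` = complex conjugation, `δ = imagUnit L`) **`exists_localComponent_pow_ne_one_of_hasWeight_one`**,
  **`exists_localMu_pow_ne_one_of_hasWeight_one`** ∕ `exists_localMu_sq_ne_one_of_hasWeight_one`: for `ψ` of WEIGHT ONE (every
  infinite place of a CM field is complex, `|e_w| = 1`), outside any finite set `T` of finite places of `L⁺` there are `v ∉ T` and
  `x ∈ E_vˣ = (Π_{w∣v} L_w)ˣ` (the unit concentrated at one `w ∣ v`) with `μ_v(x)ⁿ ≠ 1`, `μ_v := localMu L (toHeckeCharacter L ψ) v`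
  THE μ-SLOT FORMER OF THE DISPLAYED ROWS; hence (**`exists_place_muOf_localMu_ne`**) at such `v` the rows' `LemD1OfPlace.muOf`
  packages TWO DIFFERENT Step-2 characters `μ_v ≠ μ_v³` built from the rows' own `ψ` (displayed proof shapes `norm_localMu` ∕
  `continuous_localMu` ∕ `localMu_toLocalRing_eq_one_iff … ((isOscillatorChar_toHeckeCharacter_iff ψ).mpr hψ)`), and
  (**`exists_place_lemD1IndexedFamily_item1_not_lemD1_3_localMu`**) for `N ≥ 3`, every hermitian non-degenerate `J`, every
  representative `e`, the collection `(μ_v, e, 1), (μ_v³, e, 1)` on the trivial line passes (1) and VIOLATES `LemD1_3AsPrintedI`: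
  the displayed record `hD3`'s shape REJECTS non-separating carriers at infinitely many places FOR THE ROWS' OWN `μ`, using exactly
  the displayed binders `hψ : IsConjugateSymplectic` and `hw : HasWeight 1` (so `hw` is not idle for the `μ`-slot).

What this does NOT give: WHICH places (the argument is by rigidity, not constructive; in particular nothing forces a non-split
`v`); a second Step-2 character at a PRESCRIBED place; anything about the rows' own carriers `𝓢.omegaLoc v` or `χ_v`; Lem. D.1
itself.  HC_CM is NOT proved.

Cell pub-hodgecm2 (COR-CM), audit class of the END rows `hD1''` ∕ `hD3`; seat prover-pub-hodgecm2-b10.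

References: [Liu2021] Y. Liu, *Fourier–Jacobi cycles and arithmetic relative trace formula*, Camb. J. Math. 9 (2021) =
arXiv:2102.11518, Def. 4.3 (weight), Def. 4.11 (l. 2086, `μ = ⊗ μ_v`), App. D §D.1 Step 2 (l. 5219), Lemma D.1 (1), (3)
(l. 5229, 5233); [CasselsFrohlichANT1967] J. Tate, *Global class field theory*, Ch. VII §4 Prop. 4.1 (and Ch. II §6, weak
approximation); [WeilBNT1967] A. Weil, *Basic Number Theory*, Ch. VII §3 (characters of the idèle class group, ∞-types).
-/

noncomputable section

open scoped Matrix MatrixGroups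
open NumberField IsDedekindDomain
open NumberField.InfinitePlace NumberField.InfinitePlace.Completion
open Literature.Analysis
open Literature.RepresentationTheory
open Literature.NumberTheory.GaloisRepresentations (HeckeCharacter infiniteIdeles localUnits)

namespace Literature.NumberTheory.Automorphic.Liu2021.LemD1IndexedNonVacuityWeightOne

open UnitaryGroup InfiniteAdeleRing

/-! ## §1 A unitary idele class character with a non-zero exponent at a complex place has a NON-QUADRATIC local
component at some finite place -/

section General

variable (K : Type) [Field K] [NumberField K]

/-- **A continuous unitary character `ψ : C_K → S¹` of ∞-type `e` with `e_v ≠ 0` at some complex place `v` has, OUTSIDE ANY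
FINITE SET `S` of finite places, a finite place `w` and `x ∈ K_wˣ` with `ψ_w(x)ⁿ ≠ 1`** (`n ≠ 0`; `ψ_w` = the local component of the
Hecke character `toHeckeCharacter ψ`).  Otherwise every local component of `(toHeckeCharacter ψ)ⁿ` off `S` is trivial, so
`(toHeckeCharacter ψ)ⁿ = 1` by the rigidity of Hecke characters (`K^× 𝕀_K^S` is dense in `𝕀_K`: the tree's
`HeckeCharacter.eq_one_of_forall_localUnits`, [CasselsFrohlichANT1967, Ch. VII §4 Prop. 4.1]); but on the infinite idele concentrated
at `v` with value `c`, `ι_v(c) = ζ ∈ S¹`, `ψ` takes the value `ζ^{e_v}` (∞-type), and `ζ^{n e_v} ≠ 1` for a suitable `ζ`.  So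
`ψ` is of infinite order at infinitely many finite places. [cite: CasselsFrohlichANT1967, Ch. VII §4 Prop. 4.1] [cite: WeilBNT1967, Ch. VII §3] -/
theorem exists_localComponent_pow_ne_one_of_hasInfinityType (ψ : IdeleClassGroup K →ₜ* Circle)
    {e : InfinitePlace K → ℤ} (he : IdeleClassGroup.HasInfinityType K ψ e) {v : InfinitePlace K} (hv : v.IsComplex)
    (hev : e v ≠ 0) (S : Finset (HeightOneSpectrum (𝓞 K))) {n : ℕ} (hn : n ≠ 0) :
    ∃ w : HeightOneSpectrum (𝓞 K), w ∉ S ∧ ∃ x : (w.adicCompletion K)ˣ,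
      (IdeleClassGroup.toHeckeCharacter K ψ).localComponent w x ^ n ≠ 1 := by
  classical
  by_contra hall
  simp only [not_exists, not_and, not_not] at hall
  -- every local component of `χⁿ` off `S` is trivial, so `χⁿ = 1`
  have hχn : IdeleClassGroup.toHeckeCharacter K ψ ^ n = 1 :=
    HeckeCharacter.eq_one_of_forall_localUnits (S := S) fun w hw u => by
      rw [HeckeCharacter.pow_apply, ← HeckeCharacter.localComponent_apply]
      exact hall w hw u
  -- the test idele at the complex place `v`
  have hd : (n : ℤ) * e v ≠ 0 := mul_ne_zero (by exact_mod_cast hn) hev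
  obtain ⟨ζ, hζ1, hζd⟩ := Complex.exists_norm_eq_one_zpow_ne_one hd
  have hζ0 : ζ ≠ 0 := fun h0 => by simp [h0] at hζ1
  obtain ⟨c, hc⟩ := surjective_extensionEmbedding_of_isComplex hv ζ
  have hc0 : c ≠ 0 := fun h0 => hζ0 (by rw [← hc, h0, map_zero])
  let cu : (v.Completion)ˣ := Units.mk0 c hc0
  have hval : (Complex.unitPart (Units.map (extensionEmbedding v).toMonoidHom cu) : ℂ) = ζ := by
    rw [Complex.coe_unitPart]
    have : ((Units.map (extensionEmbedding v).toMonoidHom cu : ℂˣ) : ℂ) = ζ := hc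
    rw [this, hζ1]
    simp
  -- `ψ` on that idele is `ζ^{e v}` (∞-type), and `χⁿ = 1` there gives `ζ^{n e v} = 1`
  have key : (ψ (infUnitsToClass K (singleUnits K v cu)) : ℂ) = ζ ^ e v := by
    rw [he, infinityTypeChar_singleUnits, Circle.coe_zpow, hval]
  have hχu : (((IdeleClassGroup.toHeckeCharacter K ψ) (infiniteIdeles K (singleUnits K v cu)) : ℂˣ) : ℂ) = ζ ^ e v := by
    rw [IdeleClassGroup.coe_toHeckeCharacter_apply, ← infUnitsToClass_apply, key]
  have h1 := congrArg (fun f : HeckeCharacter K => ((f (infiniteIdeles K (singleUnits K v cu)) : ℂˣ) : ℂ)) hχn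
  simp only [HeckeCharacter.pow_apply, HeckeCharacter.one_apply, Units.val_pow_eq_pow_val, Units.val_one, hχu] at h1
  apply hζd
  rw [mul_comm, zpow_mul, zpow_natCast]
  exact h1

/-- The case `S = ∅`, `n = 2`: **some local component of `ψ` is not quadratic.** [cite: CasselsFrohlichANT1967, Ch. VII §4 Prop. 4.1]
[cite: WeilBNT1967, Ch. VII §3] -/
theorem exists_localComponent_sq_ne_one_of_hasInfinityType (ψ : IdeleClassGroup K →ₜ* Circle)
    {e : InfinitePlace K → ℤ} (he : IdeleClassGroup.HasInfinityType K ψ e) {v : InfinitePlace K} (hv : v.IsComplex)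
    (hev : e v ≠ 0) :
    ∃ (w : HeightOneSpectrum (𝓞 K)) (x : (w.adicCompletion K)ˣ),
      (IdeleClassGroup.toHeckeCharacter K ψ).localComponent w x ^ 2 ≠ 1 := by
  obtain ⟨w, -, x, hx⟩ := exists_localComponent_pow_ne_one_of_hasInfinityType K ψ he hv hev ∅ two_ne_zero
  exact ⟨w, x, hx⟩

end General

/-! ## §2 The CM rows: weight one ⇒ the rows' own `μ_v = localMu L (toHeckeCharacter L ψ) v` is NOT quadratic at some place -/

section CM

open Literature.NumberTheory.GelbartRogawski1991.UnitaryDualPair (imagUnit complexConj_imagUnit imagUnit_ne_zero)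
open Literature.NumberTheory.GelbartRogawski1991.UnitaryDualPair.LocalSplitting (localMu localMu_apply norm_localMu
  continuous_localMu localMu_toLocalRing_eq_one_iff)
open Literature.NumberTheory.Automorphic.IdeleClassGroup (toHeckeCharacter isUnitary_toHeckeCharacter IsConjugateSymplectic
  HasWeight HasInfinityType)
open Literature.RepresentationTheory.Liu2021 (isOscillatorChar_toHeckeCharacter_iff)

variable (L : Type) [Field L] [NumberField L] [IsCMField L]

local notation3 "cc" => (IsCMField.complexConj L)
local notation3 "L⁺" => (↥(maximalRealSubfield L))

omit [IsCMField L] in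
/-- the finite set of places of `L` above a finite set `T` of places of `L⁺`. [folklore] -/
private theorem exists_finset_placesOver (T : Finset (HeightOneSpectrum (𝓞 L⁺))) :
    ∃ S : Finset (HeightOneSpectrum (𝓞 L)), ∀ w : HeightOneSpectrum (𝓞 L), w.under (𝓞 L⁺) ∈ T → w ∈ S := by
  classical
  refine ⟨T.biUnion fun t => (Finset.univ : Finset (PlacesOver L t)).image Subtype.val, fun w hw => ?_⟩
  exact Finset.mem_biUnion.2 ⟨_, hw, Finset.mem_image.2 ⟨⟨w, rfl⟩, Finset.mem_univ _, rfl⟩⟩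

/-- **weight one ⇒ local components of infinite order at infinitely many places**: for `ψ : C_L → S¹` of weight one on a CM
field `L` (every infinite place is complex and `|e_w| = 1`), outside any finite set `S` of finite places of `L` there are a place `w`
and `x ∈ L_wˣ` with `ψ_w(x)ⁿ ≠ 1` (`n ≠ 0`). [cite: Liu2021, Def. 4.3] [cite: CasselsFrohlichANT1967, Ch. VII §4 Prop. 4.1] -/
theorem exists_localComponent_pow_ne_one_of_hasWeight_one (ψ : IdeleClassGroup L →ₜ* Circle) (hw : HasWeight L ψ 1)
    (S : Finset (HeightOneSpectrum (𝓞 L))) {n : ℕ} (hn : n ≠ 0) :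
    ∃ w : HeightOneSpectrum (𝓞 L), w ∉ S ∧ ∃ x : (w.adicCompletion L)ˣ, (toHeckeCharacter L ψ).localComponent w x ^ n ≠ 1 := by
  obtain ⟨e, he, hwe⟩ := hw
  obtain ⟨v⟩ : Nonempty (InfinitePlace L) := inferInstance
  have hv : v.IsComplex := IsTotallyComplex.isComplex v
  have hev : e v ≠ 0 := by
    have h := congrFun hwe v
    rw [IdeleClassGroup.weight_apply, Pi.one_apply] at h
    intro h0
    rw [h0] at h
    exact zero_ne_one h
  exact exists_localComponent_pow_ne_one_of_hasInfinityType L ψ he hv hev S hn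

/-- **weight one ⇒ the rows' OWN Step-2 slot has infinite order at infinitely many places of `L⁺`**: for `ψ` of weight one,
outside any finite set `T` of finite places of `L⁺` there are a place `v` and `x ∈ E_vˣ = (Π_{w ∣ v} L_w)ˣ` with `μ_v(x)ⁿ ≠ 1`
(`n ≠ 0`), `μ_v := localMu L (toHeckeCharacter L ψ) v` the μ-slot former of the displayed rows; `x` is the unit concentrated at the
place `w` of the previous theorem, `v = w|_{L⁺}`. [cite: Liu2021, Def. 4.3; App. D §D.1 Step 2 (l. 5219)] -/
theorem exists_localMu_pow_ne_one_of_hasWeight_one (ψ : IdeleClassGroup L →ₜ* Circle) (hw : HasWeight L ψ 1)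
    (T : Finset (HeightOneSpectrum (𝓞 L⁺))) {n : ℕ} (hn : n ≠ 0) :
    ∃ v : HeightOneSpectrum (𝓞 L⁺), v ∉ T ∧ ∃ x : (LocalRing L v)ˣ, localMu L (toHeckeCharacter L ψ) v x ^ n ≠ 1 := by
  classical
  obtain ⟨S, hS⟩ := exists_finset_placesOver L T
  obtain ⟨w, hwS, x, hx⟩ := exists_localComponent_pow_ne_one_of_hasWeight_one L ψ hw S hn
  let W : PlacesOver L (w.under (𝓞 L⁺)) := ⟨w, rfl⟩
  let z : (LocalRing L (w.under (𝓞 L⁺)))ˣ := MulEquiv.piUnits.symm (Pi.mulSingle W x)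
  have hz : ∀ w' : PlacesOver L (w.under (𝓞 L⁺)),
      Units.map (Pi.evalMonoidHom (fun w' : PlacesOver L (w.under (𝓞 L⁺)) => w'.1.adicCompletion L) w') z =
        (Pi.mulSingle W x : ∀ w'' : PlacesOver L (w.under (𝓞 L⁺)), (w''.1.adicCompletion L)ˣ) w' :=
    fun w' => Units.ext rfl
  refine ⟨w.under (𝓞 L⁺), fun ht => hwS (hS w ht), z, ?_⟩
  have hμ : localMu L (toHeckeCharacter L ψ) (w.under (𝓞 L⁺)) z = (toHeckeCharacter L ψ).localComponent w x := by
    rw [localMu_apply, Finset.prod_eq_single W]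
    · rw [hz, Pi.mulSingle_eq_same, HeckeCharacter.localComponent_apply]
    · intro w' _ hw'
      rw [hz, Pi.mulSingle_eq_of_ne hw', map_one, map_one]
    · intro h
      exact absurd (Finset.mem_univ W) h
  rw [hμ]
  exact hx

/-- The case `T = ∅`, `n = 2`: **weight one ⇒ `∃ v x, μ_v(x)² ≠ 1` for the rows' own `μ_v`** — the hypothesis `∃ x, μ x² ≠ 1` of
`LemD1IndexedNonVacuityAtPlace.exists_muOf_ne_of_sq_ne_one` ∕ `…exists_lemD1IndexedFamily_item1_not_lemD1_3_of_sq_ne_one` is DISCHARGED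
at some place by the displayed binder `hw : HasWeight L ψ 1`. [cite: Liu2021, Def. 4.3; App. D §D.1 Step 2 (l. 5219)] -/
theorem exists_localMu_sq_ne_one_of_hasWeight_one (ψ : IdeleClassGroup L →ₜ* Circle) (hw : HasWeight L ψ 1) :
    ∃ (v : HeightOneSpectrum (𝓞 L⁺)) (x : (LocalRing L v)ˣ), localMu L (toHeckeCharacter L ψ) v x ^ 2 ≠ 1 := by
  obtain ⟨v, -, x, hx⟩ := exists_localMu_pow_ne_one_of_hasWeight_one L ψ hw ∅ two_ne_zero
  exact ⟨v, x, hx⟩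

/-- **Outside any finite set of places of `L⁺` there is a place where the rows' packaging `LemD1OfPlace.muOf` SEPARATES two Step-2
characters built from the rows' own `ψ`**: `μ_v` and `μ_v³` (both Step-2 data with the displayed proof shapes;
`LemD1IndexedNonVacuityAtPlace.exists_muOf_ne_of_sq_ne_one` at a place of `exists_localMu_pow_ne_one_of_hasWeight_one`).  Uses the
displayed binders `hψ : IsConjugateSymplectic` (for the Step-2 clause) and `hw : HasWeight 1` (for non-quadraticity).
[cite: Liu2021, App. D §D.1 Step 2 (l. 5219); Def. 4.3] -/
theorem exists_place_muOf_localMu_ne (ψ : IdeleClassGroup L →ₜ* Circle) (hψ : IsConjugateSymplectic L ψ)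
    (hw : HasWeight L ψ 1) (T : Finset (HeightOneSpectrum (𝓞 L⁺))) :
    ∃ v : HeightOneSpectrum (𝓞 L⁺), v ∉ T ∧ ∀ (N : ℕ) (J : Matrix (Fin N) (Fin N) L) (hN : 2 ≤ N)
      (hJh : (J.map (IsCMField.complexConj L))ᵀ = J) (hJdet : J.det ≠ 0),
      ∃ (μ' : (LocalRing L v)ˣ →* ℂˣ) (hμ'n : ∀ x, ‖((μ' x : ℂˣ) : ℂ)‖ = 1) (hμ'c : Continuous fun x => ((μ' x : ℂˣ) : ℂ))
        (hμ'F : ∀ a : (v.adicCompletion L⁺)ˣ,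
          μ' (Units.map (algebraMap (v.adicCompletion L⁺) (LocalRing L v)).toMonoidHom a) = 1 ↔
            ∃ x : (LocalRing L v)ˣ, (x : LocalRing L v) * conjLocal L cc v x =
              algebraMap (v.adicCompletion L⁺) (LocalRing L v) a),
        μ' = localMu L (toHeckeCharacter L ψ) v ^ 3 ∧
        LemD1OfPlace.muOf L v cc N J (complexConj_imagUnit L) (imagUnit_ne_zero L) hN hJh hJdet μ' hμ'n hμ'c hμ'F ≠
          LemD1OfPlace.muOf L v cc N J (complexConj_imagUnit L) (imagUnit_ne_zero L) hN hJh hJdet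
            (localMu L (toHeckeCharacter L ψ) v)
            (fun x => norm_localMu L (toHeckeCharacter L ψ) v (isUnitary_toHeckeCharacter L ψ) x)
            (continuous_localMu L (toHeckeCharacter L ψ) v)
            (fun t => localMu_toLocalRing_eq_one_iff L (toHeckeCharacter L ψ) v
              ((isOscillatorChar_toHeckeCharacter_iff ψ).mpr hψ) t) := by
  obtain ⟨v, hvT, x, hx⟩ := exists_localMu_pow_ne_one_of_hasWeight_one L ψ hw T two_ne_zero
  exact ⟨v, hvT, fun N J hN hJh hJdet =>
    LemD1IndexedNonVacuityAtPlace.exists_muOf_ne_of_sq_ne_one L v cc N J (complexConj_imagUnit L) (imagUnit_ne_zero L)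
      hN hJh hJdet _ _ _ _ ⟨x, hx⟩⟩

/-- **The teeth of [Lem. D.1 (3)] AS PRINTED bite on the rows' own `μ` at infinitely many places of `L⁺`** (rank `N ≥ 3`): outside any
finite set `T` there is a place `v` such that, for every hermitian non-degenerate `J` and every representative `e`, the two-member
collection `(μ_v, e, 1), (μ_v³, e, 1)` on the trivial line — `μ_v = localMu L (toHeckeCharacter L ψ) v` with its displayed proofs —
satisfies (1) member by member and VIOLATES `LemD1_3AsPrintedI` (`μ_v ≠ μ_v³`, equal `ω`'s):
`LemD1IndexedNonVacuityAtPlace.exists_lemD1IndexedFamily_item1_not_lemD1_3_of_sq_ne_one` with its hypothesis `∃ x, μ x² ≠ 1`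
discharged by the weight.  Uses `hψ` and `hw`. [cite: Liu2021, App. D Lemma D.1 (1) and (3) (l. 5229, 5233); Def. 4.3] -/
theorem exists_place_lemD1IndexedFamily_item1_not_lemD1_3_localMu (ψ : IdeleClassGroup L →ₜ* Circle)
    (hψ : IsConjugateSymplectic L ψ) (hw : HasWeight L ψ 1) (T : Finset (HeightOneSpectrum (𝓞 L⁺))) :
    ∃ v : HeightOneSpectrum (𝓞 L⁺), v ∉ T ∧ ∀ (N : ℕ) (J : Matrix (Fin N) (Fin N) L) (hN : 2 ≤ N)
      (hJh : (J.map (IsCMField.complexConj L))ᵀ = J) (hJdet : J.det ≠ 0) (_h3 : 3 ≤ N)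
      (e : LemD1.EpsRep (LemD1OfPlace.standingData L v cc N J (complexConj_imagUnit L) (imagUnit_ne_zero L) hN hJh hJdet)),
      ∃ Lf : LemD1IndexedFamily (v.adicCompletion L⁺) (LocalRing L v) N (Fin 2),
        Lf.S = LemD1OfPlace.standingData L v cc N J (complexConj_imagUnit L) (imagUnit_ne_zero L) hN hJh hJdet ∧
        (∀ i, (Lf.eps i).1 = e.1) ∧ (∀ i, (Lf.chi i).1 = 1) ∧
        (Lf.mu 0).1 = localMu L (toHeckeCharacter L ψ) v ∧ (Lf.mu 1).1 = localMu L (toHeckeCharacter L ψ) v ^ 3 ∧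
        Lf.Item1AsPrinted ∧ Lf.mu 0 ≠ Lf.mu 1 ∧ ¬ LemD1_3AsPrintedI Lf := by
  obtain ⟨v, hvT, x, hx⟩ := exists_localMu_pow_ne_one_of_hasWeight_one L ψ hw T two_ne_zero
  exact ⟨v, hvT, fun N J hN hJh hJdet h3 e =>
    LemD1IndexedNonVacuityAtPlace.exists_lemD1IndexedFamily_item1_not_lemD1_3_of_sq_ne_one L v cc N J (complexConj_imagUnit L)
      (imagUnit_ne_zero L) hN hJh hJdet h3 (localMu L (toHeckeCharacter L ψ) v)
      (fun x => norm_localMu L (toHeckeCharacter L ψ) v (isUnitary_toHeckeCharacter L ψ) x)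
      (continuous_localMu L (toHeckeCharacter L ψ) v)
      (fun t => localMu_toLocalRing_eq_one_iff L (toHeckeCharacter L ψ) v
        ((isOscillatorChar_toHeckeCharacter_iff ψ).mpr hψ) t)
      ⟨x, hx⟩ e⟩

end CM

end Literature.NumberTheory.Automorphic.Liu2021.LemD1IndexedNonVacuityWeightOne

end
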